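import Summits.FinalStateConjecture.FinalStateConjecture.Theses.SwallowTheDatum
import Summits.FinalStateConjecture.FinalStateConjecture.Theorems.KerrShieldedDataExist.Negative.BentSliceConormal
import Literature.Geometry.Lorentzian.ModelData
import Literature.Geometry.Lorentzian.AsymptoticallyFlatCompleteness
import HarnessLib

/-!
# Line `plug-the-second-sheet` for crux `KerrShieldedDataExist` (stmt-FinalStateConjecture-10055)

Crux-plan skeleton (planner-cruxplan-stmt-FinalStateConjecture-10055-plug-the-second-shee-0, 2026-08-16).
Idea card: `Cruxes/KerrShieldedDataExist/Ideas/plug-the-second-sheet.md`; line card: `Lines/plug-the-second-sheet.md`.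

THE LINE (a = 0, no Einstein evolution). A vacuum datum on `E3` which is EXACTLY isotropic Schwarzschild
`((1 + M/2ρ)⁴ δ, 0)` outside a ball `{ρ ≤ ρ₃}`, `ρ₃ < M/2` — i.e. exact on the asymptotic end, on sheet 1, through
the Einstein–Rosen throat `ρ = M/2` and on a sheet-2 collar `ρ₃ < ρ < M/2`, with the second asymptotic end replaced
by a regular vacuum 3-ball (the PLUG) — is re-sliced inside the explicit Kruskal geometry: the crux's hard-coded
bent Kerr–Schild/Boyer–Lindquist leaf `t* = T_{M,0}(r)`, `r > r₁` (any `r₁ ∈ (0, 2M)`; it lies in Kruskal I ∪ II),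
is continued by a spherically symmetric spacelike CONNECTOR through region II, across the left future horizon into
region III (all inside the second, reflected ingoing Kerr–Schild chart `t*_L = −t*_R + 4M log(1 − r/2M)` of the SAME
Kerr–Schild formulas), landing flat on the sheet-2 part of `{T = 0}` inside the exact collar, then continued by the
plugged datum. Outside the plug every piece of the final datum is given by closed formulas.

RESHAPE by the lead (prover-line-stmt-FinalStateConjecture-10055-0, cycle 1, 2026-08-16): the two engine stubs
`stub_ttShellCap` (1a) + `stub_massGluing` (1b) are MERGED into the engine-agnostic `stub_plugData` (their conjunction's
output, with the depth constant `ρ₃ < M/40` that every gluing construction delivers by scaling and that lets the harvest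
use the MIRROR LEAF through region III); `stub_harvest` is SPLIT at the skeleton level into `stub_ricciFlatKS`
(Ricci-flatness of Kerr–Schild Schwarzschild, the `a = 0` case of the named fact `Kerr.isRicciFlat`),
`stub_inducedVacuumData` (generic: a smooth spacelike immersion of a chart domain `U ⊆ E3` into the Ricci-flat
Kerr–Schild chart with a smooth unit normal carries a vacuum `InitialDataSet` with the induced `(h, K_ν)`) and the
assembly `stub_harvest` proper, which receives those two as hypotheses; `stub_sliceClause` additionally exports the
smoothness of the literal height and a SMOOTH representative of the future unit normal (consumed by the harvest).
Original planner text of the engine follows.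

THE PLUG (this card's engine, formerly stubs 1a + 1b): maximal conformally flat data `(φ_λ⁴ δ, φ_λ⁻² σ_λ)` on `E3` with a LARGE
high-frequency six-polarisation TT shell `σ_λ` supported in `1 < ρ < 2` (polynomial symbol `|ξ|⁶ P_TT(ξ)`, so `σ_λ` is
exactly TT and shell-supported); `−8Δφ_λ = |σ_λ|² φ_λ⁻⁷`, `φ_λ → 1`, is solvable for every `σ`, and as `λ → ∞`
`|σ_λ|² ⇀ A² χ(ρ)²` is RADIAL, so `φ_λ → φ_eff` with `φ_eff = 1 + β/ρ` EXACTLY on `ρ ≥ 2`, `β = β(A) ≈ 1.02 A^{1/4}`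
(toy jobs j005367, j006805: `β = 4.80, 9.59, 18.1` at `A = 10³, 10⁴, 10⁵`), in `C^∞` on compact parts of `{ρ > 2}`
(harmonic functions) — `stub_ttShellCap` (approximate plug of FIXED mass `M₀ = 2β` to arbitrary `C⁶` precision on a
fixed annulus behind the throat); then ONE-parameter Corvino scalar-curvature gluing on that sheet-2 annulus to exact
Schwarzschild of a nearby mass `M` (cokernel `ker L* = span{N}`, killed by the mass flux) — `stub_massGluing`.
The alternative engine (Beig–Ó Murchadha critical sequence + weak-field Corvino, card `bag-of-gold-throat-recession`)
proves the same two stubs' conjunction (`PlugData` below).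

DISPROOF USED (`Cruxes/KerrShieldedDataExist/Disproof.lean`, gen 2, and the landed
`Theorems/KerrShieldedDataExist/Negative/*.lean`, imported here): there is no `_false_without_` theorem (∃-crux,
verdict RESISTS); the refuted strengthenings are honoured — `no_window_of_not_subextremal` (we are sub-extremal:
`a = 0 < M`), unbent slice / `φ = id` + tautological end chart (`§7`: we keep the literal bent `T` — the far leaf is
the Boyer–Lindquist `{t = 0}` slice — and read the end in the ISOTROPIC chart, `stub_isotropicEnd`); the slice clause
rests on the landed certificate `Negative.conormalForm_bentSlope_neg` + `Negative.graph`/`psi_eq_graph`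
(`stub_sliceClause`); the domain-of-dependence/connector step re-derived in Disproof §8(a) is inside `stub_harvest`.
`ledger negatives --problem FinalStateConjecture` = 0 (2026-08-16).

Composition `KerrShieldedDataExist_of` has no `sorry` of its own (it applies the six stubs by name, as the skeleton audit
requires): plug → slice clause at `r₁ := M` → harvest (fed with `stub_ricciFlatKS`, `stub_inducedVacuumData`) →
isotropic end → completeness by the tree's PROVED `isComplete_of_isSoleEnd_holds` → `admissibleVacuumData` → the crux by name.
-/

set_option linter.dupNamespace false

noncomputable section

open Set Function Filter Topology
open scoped Manifold ContDiff Topology InnerProductSpace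
open Literature.Geometry.Lorentzian
open Summit.FinalStateConjecture.FinalStateConjecture.Theorems.KerrShieldedDataExist

namespace Summit.FinalStateConjecture.FinalStateConjecture.Cruxes.KerrShieldedDataExist.PlugTheSecondSheet

/-- **Stub 1 — PlugData (the engine-agnostic output of the plug; merges the planner's stubs 1a `stub_ttShellCap` and
1b `stub_massGluing`; HARDEST, held by the lead).** There are a mass `M > 0`, a depth `0 < ρ₃ < M/40` and a smooth
datum `D₀` on `E3` solving the vacuum constraints which is EXACTLY time-symmetric isotropic Schwarzschild
`((1 + M/2ρ)⁴ δ, 0)` on `{ρ > ρ₃}` — i.e. exact on the end, on sheet 1, through the Einstein–Rosen throat `ρ = M/2`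
and on the sheet-2 collar `ρ₃ < ρ < M/2` (which reaches beyond sheet-2 areal radius `8M`, `ρ(8M)|₂ = M²/(4ρ(8M)|₁)
≈ 0.036 M > M/40`), the second end being replaced by a regular vacuum 3-ball. Engines (line card): HF six-polarisation
TT-shell cap + one-parameter Corvino mass gluing on a sheet-2 annulus (cokernel `span{N}` killed by the mass flux,
IVT), or Beig–Ó Murchadha criticality + weak-zone Corvino (card `bag-of-gold-throat-recession`); nearest print:
Corvino, CMP 214 (2000) Thm 1 and §4; Chruściel–Delay, Mém. SMF 94 (2003) = gr-qc/0301073, Thm 5.9 (arXiv numbering)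
and §8.9 p. 33 (inner-punctured exact Schwarzschild balls, one mass parameter by continuity). Any such construction
gives every `ρ₃/M > 0` by scaling. Size XL (weighted elliptic theory on a domain, Fredholm with 1-dim cokernel,
degree/IVT in the mass; nothing of it in Mathlib) — to be reduced to faithful named facts.
[cite: arXiv:gr-qc/0301073, Thm 5.9, §8.9] [cite: BartnikIsenberg2004, §4] [cite: BeigChruscielSchoen2005] -/
theorem stub_plugData :
    ∃ (M ρ₃ : ℝ) (D₀ : InitialDataSet (𝓡 3) E3), 0 < M ∧ 0 < ρ₃ ∧ ρ₃ < M / 40 ∧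
      (∀ [D₀.metric.HasLeviCivita], D₀.IsVacuumConstraintSolution) ∧
      (∀ y : E3, ρ₃ < ‖y‖ →
        (∀ v w : E3, D₀.h.inner y v w = Schwarzschild.conformalFactor M y ^ 4 * ⟪v, w⟫_ℝ) ∧ D₀.k y = 0) := by
  sorry

/-- **Stub 2 — the slice clause at zero spin (with smooth exports).** For `M > 0`, `r₁ > 0`: (i) the literal height
`Negative.bentHeight M 0` is `C^∞` on `ℝ` (≡ 0 on `r < 4M`; `χ(r/4M − 1)·(2M log(r − 2M) − 2M log 2M)` on `r > 2M`,
`KerrShieldedSettles.Negative.blHeight_spin_zero`); (ii) the graph `ψ = Negative.graph M 0 r₁` (`y ↦ (T(‖y‖), y)`,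
the crux's pinned immersion, `Negative.psi_eq_graph`; it is `Kerr.leafEmbed 0 r₁ (T ∘ ‖·‖) 0` up to `0 + ·`) is a
spacelike immersion of `Kerr.slice 0 r₁ = {‖y‖ > r₁}` into `(Kerr.region 0 r₁, g_{M,0})`; (iii) it carries a future
unit normal given by a representative `N : E3 → E4` smooth on the slice (intended: `N = W/√(−g(W,W))`,
`W = −coSharp M 0 x n`, `n = leafConormal (T∘‖·‖) x = dt* − T′(r) dr`). Content left after the landed certificate
`Negative.conormalForm_bentSlope_neg` (`−r² + T′²r² − 2Mr(1+T′)² < 0` ∀ r > 0): `fderiv (T∘r) = T′(r) • Kerr.radiusGrad 0`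
(`Kerr.hasFDerivAt_radius_slice`, `Negative.hasDerivAt_bentHeight`), `g⁻¹(n,n) = conormalForm/r²`
(`Kerr.leafConormal_coSharp_of_radial`, `Kerr.blSigma 0 y = ‖y‖²`), tangent vectors `(T′dr v, v)` are `g`-orthogonal to
`W` hence spacelike (`LorentzianMetric.isSpacelike_of_orthogonal`, pattern `Kerr.isSpacelikeImmersion_leafEmbed`),
`g(V, W) = −n(V) = −(1 + 2H(1+T′)) < 0` (`Kerr.leafConormal_timeVector_of_radial`, `Negative.bentSlope_nonneg`).
Size M. [cite: arXiv08110354, §5.1] [cite: Cook2000, §3.2.2] -/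
theorem stub_sliceClause :
    ∀ [Kerr.Facts] (M r₁ : ℝ) (hM : 0 ≤ M), 0 < M → 0 < r₁ →
      ContDiff ℝ ∞ (Negative.bentHeight M 0) ∧
      (Kerr.smoothMetric M 0 r₁).IsSpacelikeImmersion 𝓘(ℝ, E3) (Negative.graph M 0 r₁) ∧
      ∃ N : E3 → E4, ContDiffOn ℝ ∞ N (Kerr.slice 0 r₁ : Set E3) ∧
        (Kerr.smoothMetric M 0 r₁).IsFutureUnitNormal 𝓘(ℝ, E3) ((Kerr.timeOrientation M 0 r₁ hM).ofLE le_top)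
          (Negative.graph M 0 r₁) (fun y ↦ N y) := by
  sorry

/-- **Stub 3 — Ricci-flatness of Kerr–Schild Schwarzschild** (the `a = 0` case of the named fact `Kerr.isRicciFlat`,
`KerrSchild.lean`, stated for the `C^∞` metric `Kerr.smoothMetric = (Kerr.metric).ofLE le_top` that the hypersurface
API consumes): `Ric(g_{M,0}) = 0` on every chart domain `{‖x⃗‖ > max r₀ 0}`. For `a = 0`,
`g = η + (2M/r) ℓ ⊗ ℓ`, `ℓ = (1, x⃗/r)`, `r = ‖x⃗‖` (`Kerr.radius_zero_left`): a chart computation with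
`ChartConnection.val_riemann_eq` / the Koszul form of `ChartCalculus.lean` in a point-adapted orthonormal frame (as in
`Kerr.scalarCurvature_data_zero`, `KerrDataSchwarzschildMetric.lean`), or O'Neill's warped-product curvature formulas.
Size L (mechanical). Land the computation in `Literature/Geometry/Lorentzian/` as the discharge
`Kerr.ricci_smoothMetric_zero_spin` / `Kerr.isRicciFlat` at `a = 0`, then this stub is one line.
[cite: KerrSchild1965, §3] [cite: ONeill1995, Ch. 2, Thm. 2.6.1] -/
theorem stub_ricciFlatKS :
    ∀ [Kerr.Facts] (M r₀ : ℝ) [(Kerr.smoothMetric M 0 r₀).HasLeviCivita] (x : Kerr.region 0 r₀),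
      (Kerr.smoothMetric M 0 r₀).ricci x = 0 := by
  sorry

/-- **Stub 4 — induced vacuum data of a spacelike immersion into the Kerr–Schild chart (generic packaging).**
Let `U ⊆ E3` be a chart domain, `f : U → Kerr.region 0 r₀` a spacelike immersion for `g = Kerr.smoothMetric M 0 r₀`
with smooth representative `Φ` (`f y = Φ y`), and `ν` a unit normal of sign `−1` along `f` with smooth representative
`N`. If `Ric(g) = 0` on the chart domain, then `U` carries a smooth initial data set `D = (f^*g, K_ν)`:
`D.h.inner = inducedBilin` (`inducedRiemannianMetric`, smoothness by `contMDiff_pullbackBilin_holds`), `D.k = K_ν`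
(`secondFundamentalForm`, as a continuous bilinear form like `Kerr.sliceK`; symmetric by
`secondFundamentalForm_symm_holds`; SMOOTH by the coordinate formula `OpensChart.secondFundamentalForm_eq_of_repr`
— `K(v,w) = G(Φ y)(DN(y)v + Γ_{Φ y}(N y)(DΦ(y)v), DΦ(y)w)` — and `OpensSection.contMDiff_bilinSection`), and `D`
solves the vacuum constraints (Gauss: `scalarCurvature_inducedMetric_sub_normSq_add_sq_eq_zero`; Codazzi:
`divergence_sub_mvfderiv_meanCurvature_eq_zero`, `HypersurfaceMomentumConstraint.lean`; `D.metric = inducedMetric`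
definitionally via `PseudoRiemannianMetric.ofRiemannian`; `HasLeviCivita` instances are `Prop`s, any two agree).
The sign of `ν` is irrelevant for the constraints. Size L. Reusable by every explicit-slice witness of the summit.
[cite: ChoquetBruhat2009, Ch. VI, Thm. 3.3] [cite: ONeill1983, Ch. 4, Lemma 4.4] -/
theorem stub_inducedVacuumData :
    ∀ [Kerr.Facts] (M r₀ : ℝ) (U : TopologicalSpace.Opens E3) (Φ N : E3 → E4)
      (f : U → Kerr.region 0 r₀) (ν : NormalField 𝓘(ℝ, E4) f),
      (∀ [(Kerr.smoothMetric M 0 r₀).HasLeviCivita] (x : Kerr.region 0 r₀), (Kerr.smoothMetric M 0 r₀).ricci x = 0) →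
      (∀ y : U, ((f y : Kerr.region 0 r₀) : E4) = Φ y) → (∀ y : U, ν y = N y) →
      ContDiffOn ℝ ∞ Φ (U : Set E3) → ContDiffOn ℝ ∞ N (U : Set E3) →
      (Kerr.smoothMetric M 0 r₀).IsSpacelikeImmersion 𝓘(ℝ, E3) f →
      (Kerr.smoothMetric M 0 r₀).IsUnitNormal 𝓘(ℝ, E3) f ν (-1) →
      ∃ D : InitialDataSet 𝓘(ℝ, E3) U,
        (∀ y : U, D.h.inner y = (Kerr.smoothMetric M 0 r₀).inducedBilin 𝓘(ℝ, E3) f y) ∧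
        (∀ [(Kerr.smoothMetric M 0 r₀).HasLeviCivita] (y : U),
          (D.k y).toLinearMap₁₂ = (Kerr.smoothMetric M 0 r₀).secondFundamentalForm 𝓘(ℝ, E3) f ν y) ∧
        (∀ [D.metric.HasLeviCivita], D.IsVacuumConstraintSolution) := by
  sorry

/-- **Stub 5 — the harvest / assembly (Transfer `PlugData → crux`; explicit Kruskal geometry, `a = 0`).**
Given PlugData `(M, ρ₃ < M/40, D₀)`, a junction radius `r₁ ∈ (0, 2M)`, the slice-clause exports at `r₁` (smooth literal
height, spacelike graph `ψ = Negative.graph M 0 r₁`, future unit normal with smooth representative `N₀`),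
Ricci-flatness of every Kerr–Schild Schwarzschild chart and the induced-vacuum-data packaging (the statements of
`stub_ricciFlatKS`, `stub_inducedVacuumData`, fed by the composition), there is a datum `D` on `E3` which (i) solves the
vacuum constraints, (ii) is EXACTLY isotropic Schwarzschild `((1 + M/2ρ)⁴δ, 0)` outside some ball (the far leaf
`r ≥ 8M` is the time-symmetric BL slice read through `r = ρ(1 + M/2ρ)²`), and (iii) satisfies the crux's shielding
block verbatim (intended: `a = 0`, this `M`, this `r₁`, `T = Negative.bentHeight M 0 = literal` by `rfl`,
`ψ = Negative.graph M 0 r₁`, `ν = N₀`, `φ` = inclusion `{‖y‖ > r₁} ↪ E3` bent radially to the isotropic radius beyond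
`8M`, compact complement = closed ball). GEOMETRY (lead's mirror design; the planner's β-boost connector is the
alternative): in Kruskal(M) the hypersurface is LEAF `{t*_R = T(r), r > r_c}` (regions I ∪ II; `T ≡ 0` on `r ≤ 4M`)
∪ ROUNDED CORNER at a sphere `r_c ∈ (0, r₁)` of region II ∪ MIRROR LEAF `{t*_L = c + T(r), r > r_c}` (regions II ∪ III,
the image of the leaf under the Kruskal reflection `X ↦ −X`, an isometry preserving the time orientation; both
ingoing charts carry the SAME `Kerr.smoothMetric M 0 r₀` formulas, overlap map on II:
`t*_L = −t*_R + 4M log(1 − r/2M) + const`, same `x⃗`), whose far part `{t_L = const, r ≥ 8M}` is time-symmetric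
`((1+M/2ρ)⁴δ, 0)` in sheet-2 isotropic radius `ρ = M²/(4ρ₁(r))` and is continued by `D₀` (exact down to
`ρ₃ < M/40 < ρ(8M)|₂`). The two KS slices `{t*_R = 0}` and `{t*_L = c}` (`c = 4M log λ`, `λ ∈ (0,1)`) cross
transversally in region II at `r_c = 2M(1 − λ)`, both with tangent in the open quadrant `{dU > 0 > dV}` = the radial
spacelike cone, which is convex: round the corner by any smooth decreasing curve in the `(U, V)` plane, realised in
chart R as a spherically symmetric parametrised immersion `y ↦ (τ(‖y‖), (ϱ(‖y‖)/‖y‖) y)`. Every piece is a smooth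
spacelike immersion of an annulus/exterior domain of `E3` into some `Kerr.region 0 r₀` with explicit smooth future
unit normal ⇒ vacuum data by `hInd` + `hRic`; pieces agree on open overlaps (same hypersurface, isometric charts,
normals in the same time-cone) ⇒ one smooth `InitialDataSet` on `E3` defined by global radial formulas; constraints
transfer along `Subtype.val` by `InitialDataSet.isVacuumConstraintSolution_comap` / `hamiltonianConstraintFn_comap`
(`InitialDataPullback.lean`); the block's pull-back identities hold by DEFINITION of `D` on `range φ`.
Size XL (Lean: explicit corner curve, two charts, piecewise assembly). [cite: LiMei2020, §2.2] [cite: ONeill1983, Ch. 13]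
[cite: Wald1984, §6.4] [cite: arXiv08110354, §5.1] -/
theorem stub_harvest :
    ∀ [Kerr.Facts] (M ρ₃ : ℝ) (D₀ : InitialDataSet (𝓡 3) E3) (hM : 0 ≤ M), 0 < M → 0 < ρ₃ → ρ₃ < M / 40 →
      (∀ [D₀.metric.HasLeviCivita], D₀.IsVacuumConstraintSolution) →
      (∀ y : E3, ρ₃ < ‖y‖ →
        (∀ v w : E3, D₀.h.inner y v w = Schwarzschild.conformalFactor M y ^ 4 * ⟪v, w⟫_ℝ) ∧ D₀.k y = 0) →
      -- Ricci-flatness of every Kerr–Schild Schwarzschild chart (statement of `stub_ricciFlatKS`)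
      (∀ (r₀ : ℝ) [(Kerr.smoothMetric M 0 r₀).HasLeviCivita] (x : Kerr.region 0 r₀),
        (Kerr.smoothMetric M 0 r₀).ricci x = 0) →
      -- induced vacuum data of spacelike immersions (statement of `stub_inducedVacuumData` at this `M`)
      (∀ (r₀ : ℝ) (U : TopologicalSpace.Opens E3) (Φ N : E3 → E4)
        (f : U → Kerr.region 0 r₀) (ν : NormalField 𝓘(ℝ, E4) f),
        (∀ [(Kerr.smoothMetric M 0 r₀).HasLeviCivita] (x : Kerr.region 0 r₀), (Kerr.smoothMetric M 0 r₀).ricci x = 0) →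
        (∀ y : U, ((f y : Kerr.region 0 r₀) : E4) = Φ y) → (∀ y : U, ν y = N y) →
        ContDiffOn ℝ ∞ Φ (U : Set E3) → ContDiffOn ℝ ∞ N (U : Set E3) →
        (Kerr.smoothMetric M 0 r₀).IsSpacelikeImmersion 𝓘(ℝ, E3) f →
        (Kerr.smoothMetric M 0 r₀).IsUnitNormal 𝓘(ℝ, E3) f ν (-1) →
        ∃ D : InitialDataSet 𝓘(ℝ, E3) U,
          (∀ y : U, D.h.inner y = (Kerr.smoothMetric M 0 r₀).inducedBilin 𝓘(ℝ, E3) f y) ∧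
          (∀ [(Kerr.smoothMetric M 0 r₀).HasLeviCivita] (y : U),
            (D.k y).toLinearMap₁₂ = (Kerr.smoothMetric M 0 r₀).secondFundamentalForm 𝓘(ℝ, E3) f ν y) ∧
          (∀ [D.metric.HasLeviCivita], D.IsVacuumConstraintSolution)) →
      ContDiff ℝ ∞ (Negative.bentHeight M 0) →
      ∀ (r₁ : ℝ), 0 < r₁ → r₁ < 2 * M →
        (Kerr.smoothMetric M 0 r₁).IsSpacelikeImmersion 𝓘(ℝ, E3) (Negative.graph M 0 r₁) →
        ∀ (N₀ : E3 → E4), ContDiffOn ℝ ∞ N₀ (Kerr.slice 0 r₁ : Set E3) →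
          (Kerr.smoothMetric M 0 r₁).IsFutureUnitNormal 𝓘(ℝ, E3) ((Kerr.timeOrientation M 0 r₁ hM).ofLE le_top)
            (Negative.graph M 0 r₁) (fun y ↦ N₀ y) →
          ∃ D : InitialDataSet (𝓡 3) E3,
            (∀ [D.metric.HasLeviCivita], D.IsVacuumConstraintSolution) ∧
            (∃ R : ℝ, 0 < R ∧ ∀ y : E3, R < ‖y‖ →
              (∀ v w : E3, D.h.inner y v w = Schwarzschild.conformalFactor M y ^ 4 * ⟪v, w⟫_ℝ) ∧ D.k y = 0) ∧
            ∃ (a r₁ : ℝ) (hM : 0 ≤ M) (T : ℝ → ℝ) (φ : Literature.Geometry.Lorentzian.Kerr.slice a r₁ → Literature.Geometry.Lorentzian.E3) (ψ : Literature.Geometry.Lorentzian.Kerr.slice a r₁ → Literature.Geometry.Lorentzian.Kerr.region a r₁) (ν : Literature.Geometry.Lorentzian.NormalField 𝓘(ℝ, Literature.Geometry.Lorentzian.E4) ψ), |a| < M ∧ Literature.Geometry.Lorentzian.Kerr.rMinus M a < r₁ ∧ r₁ < Literature.Geometry.Lorentzian.Kerr.rPlus M a ∧ T = (fun r : ℝ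 => Real.smoothTransition (r / (4 * M) - 1) * (((M) / Real.sqrt ((M) ^ 2 - (a) ^ 2)) * (Literature.Geometry.Lorentzian.Kerr.rPlus M a * Real.log (r - Literature.Geometry.Lorentzian.Kerr.rPlus M a) - Literature.Geometry.Lorentzian.Kerr.rMinus M a * Real.log (r - Literature.Geometry.Lorentzian.Kerr.rMinus M a)) - ((M) / Real.sqrt ((M) ^ 2 - (a) ^ 2)) * (Literature.Geometry.Lorentzian.Kerr.rPlus M a * Real.log ((4 * M) - Literature.Geometry.Lorentzian.Kerr.rPlus M a) - Literature.Geometry.Lorentzian.Kerr.rMinus M a * Real.log ((4 * M) - Literature.Geometry.Lorentzian.Kerr.rMinus M a)))) ∧ IsCompact (Set.range φ)ᶜ ∧ Topology.IsOpenEmbedding φ ∧ ContMDiff 𝓘(ℝ, Literature.Geometry.Lorentzian.E3) (𝓡 3) ((⊤ : ℕ∞) : WithTop ℕ∞) φ ∧ (∀ y : Literature.Geometry.Lorentzian.Kerr.slice a r₁, (ψ y : Literature.Geometry.Lorentzian.E4) = Literature.Geometry.Lorentzian.E4.ofTimeSpace (T (Literature.Geometry.Lorentzian.Kerr.radius a (Literature.Geometry.Lorentzian.E4.ofTimeSpace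 0 (y : Literature.Geometry.Lorentzian.E3)))) (y : Literature.Geometry.Lorentzian.E3)) ∧ (Literature.Geometry.Lorentzian.Kerr.smoothMetric M a r₁).IsSpacelikeImmersion 𝓘(ℝ, Literature.Geometry.Lorentzian.E3) ψ ∧ (Literature.Geometry.Lorentzian.Kerr.smoothMetric M a r₁).IsFutureUnitNormal 𝓘(ℝ, Literature.Geometry.Lorentzian.E3) ((Literature.Geometry.Lorentzian.Kerr.timeOrientation M a r₁ hM).ofLE le_top) ψ ν ∧ (∀ y : Literature.Geometry.Lorentzian.Kerr.slice a r₁, Literature.Geometry.Lorentzian.pullbackBilin (I := 𝓡 3) (I' := 𝓘(ℝ, Literature.Geometry.Lorentzian.E3)) φ (D).h.inner y = Literature.Geometry.Lorentzian.pullbackBilin (I := 𝓘(ℝ, Literature.Geometry.Lorentzian.E4)) (I' := 𝓘(ℝ, Literature.Geometry.Lorentzian.E3)) ψ (Literature.Geometry.Lorentzian.Kerr.smoothMetric M a r₁).val y) ∧ (∀ [(Literature.Geometry.Lorentzian.Kerr.smoothMetric M a r₁).HasLeviCivita] (y : Literature.Geometry.Lorentzian.Kerr.slice a r₁), (Literature.Geometry.Lorentzian.pullbackBilin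 (I := 𝓡 3) (I' := 𝓘(ℝ, Literature.Geometry.Lorentzian.E3)) φ (D).k y).toLinearMap₁₂ = (Literature.Geometry.Lorentzian.Kerr.smoothMetric M a r₁).secondFundamentalForm 𝓘(ℝ, Literature.Geometry.Lorentzian.E3) ψ ν y) := by
  sorry

/-- **Stub 6 — an exactly isotropic-Schwarzschild far region is a sole DR-admissible end.**
If a datum on `E3` equals `((1 + M/2‖y‖)⁴ δ, 0)` outside the ball of radius `R` (`M ≥ 0`), then `E3` has an
asymptotically flat end (`U = exteriorRegion R`, tautological chart `Diffeomorph.refl`, closed at infinity) which is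
its sole end (complement of a far region = closed ball, compact) and on which the data are strongly asymptotically
flat with mass `M` at the Dafermos–Rodnianski rates: `hCoeff − (1 + 2M/r)δ = ((1+M/2r)⁴ − 1 − 2M/r)δ =
(3M²/2r² + M³/2r³ + M⁴/16r⁴)δ = O₂(r⁻²) = o₂(r⁻¹)`, `kCoeff ≡ 0 = o₁(r⁻²)` (symbol calculus `IsBigOSmooth` of
`DecaySymbols.lean`: `isBigOSmooth_inv_norm`, `.pow`, `.smul_const`, `congr_far`; pattern
`ModelDataProofs.hCoeff_inclusionAFEnd_apply`, `TrivialDataAdmissible.isSoleEnd_trivialAFEnd`). This is where the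
refuted mutation "Kerr–Schild end / tautological chart" (`Kerr.not_isStronglyAsymptoticallyFlatDR_data`, Disproof §7)
is avoided. Reusable by every `a = 0` witness. Size M. [cite: DafermosRodnianski2013, App. B.2.3] [cite: Bartnik1986, §1] -/
theorem stub_isotropicEnd :
    ∀ (D : InitialDataSet (𝓡 3) E3) (M R : ℝ), 0 ≤ M → 0 < R →
      (∀ y : E3, R < ‖y‖ → (∀ v w : E3, D.h.inner y v w = Schwarzschild.conformalFactor M y ^ 4 * ⟪v, w⟫_ℝ) ∧ D.k y = 0) →
      ∃ e : AFEnd E3, e.IsSoleEnd ∧ e.IsStronglyAsymptoticallyFlatDR D M := by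
  sorry

/-- **Composition (kernel-checked; no `sorry` of its own — it applies the six registered stubs by name and concludes the
crux BY NAME).** Logical shape: `stub_plugData → stub_sliceClause → stub_ricciFlatKS → stub_inducedVacuumData →
stub_harvest → stub_isotropicEnd → KerrShieldedDataExist`. Junction radius `r₁ := M ∈ (0, 2M)`; harvest gives `D`
with the vacuum constraints, an exactly isotropic-Schwarzschild far region and the shielding block; `stub_isotropicEnd`
gives the sole DR end; completeness is the tree's PROVED `isComplete_of_isSoleEnd_holds` (Gordon's criterion); hence
`D ∈ admissibleVacuumData E3` and the crux. [folklore] -/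
theorem KerrShieldedDataExist_of :
    Summit.FinalStateConjecture.FinalStateConjecture.Theses.SwallowTheDatum.KerrShieldedDataExist := by
  -- the six registered stubs, used BY NAME (skeleton audit: no free hypotheses; sorries live only in `stub_*`)
  have h1 := stub_plugData
  have h2 := @stub_sliceClause
  have h3 := @stub_ricciFlatKS
  have h4 := @stub_inducedVacuumData
  have h5 := @stub_harvest
  have h6 := stub_isotropicEnd
  intro inst
  obtain ⟨M, ρ₃, D₀, hMpos, hρ₃, hρ₃M, hvac₀, hexact₀⟩ := h1
  have h2M : M < 2 * M := by linarith
  obtain ⟨hT, hsp, N₀, hN₀, hν⟩ := h2 M M hMpos.le hMpos hMpos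
  obtain ⟨D, hvac, ⟨R, hR, hfar⟩, hblock⟩ :=
    h5 M ρ₃ D₀ hMpos.le hMpos hρ₃ hρ₃M @hvac₀ hexact₀ (fun r₀ ↦ @h3 _ M r₀) (fun r₀ ↦ @h4 _ M r₀) hT
      M hMpos h2M hsp N₀ hN₀ hν
  obtain ⟨e, hsole, hDR⟩ := h6 D M R hMpos.le hR hfar
  have hadm : D ∈ admissibleVacuumData E3 := by
    refine mem_admissibleVacuumData_iff.mpr ⟨?_, e, M, hsole, hDR⟩
    intro hLC
    exact ⟨hvac, isComplete_of_isSoleEnd_holds E3 D e M 1 2 2 1 zero_le_one hDR hsole⟩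
  exact ⟨D, hadm, M, hblock⟩

end Summit.FinalStateConjecture.FinalStateConjecture.Cruxes.KerrShieldedDataExist.PlugTheSecondSheet

end
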